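import Literature.Computability.QuantumComplexity.ZXCalculusCliffordLemmas
import HarnessLib

/-!
# `ZX_{π/4}` modulo the calculus: the scalar `1 + i`, the green `π/2` state, Euler with scalars

Topic `Literature/Computability/QuantumComplexity`, continuing `ZXCalculusCliffordLemmas.lean`
(layer T1 of the formalisation of `JeandelPerdrixVilmart2018_completeness`; the lemma numbers are
those of the appendix of the full version, LMCS 16(2):11, App. A).

* the `π`-commutation rule (K) on a green state: `√2 ⊗ (Z^{(0,1)}(α) ⨾ X^{(1,1)}(π)) =
  (X^{(0,1)}(π) ⨾ Z^{(1,0)}(α)) ⊗ Z^{(0,1)}(-α)` (`sqrt_two_par_Z_state_seq_X_pi`); products and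
  cancellation of the unit scalars `X^{(0,1)}(π) ⨾ Z^{(1,0)}(α) = √2 e^{iα}` (`dumbbell_four_mul`,
  `cancel_dumbbell_four`);
* **LMCS Lemma 14** (`Z_dot_two_eq`): `Z^{(0,0)}(π/2) = X^{(0,1)}(π) ⨾ Z^{(1,0)}(π/4)`, i.e.
  `1 + i = √2 e^{iπ/4}`, by the printed route (E), (H), (EU), (K), Lemma 6, (SUP), Hopf, Lemma 6,
  (IV); and its conjugate `Z^{(0,0)}(-π/2) = X^{(0,1)}(π) ⨾ Z^{(1,0)}(-π/4)` (`Z_dot_neg_two_eq`);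
* **LMCS Lemma 15** (`Z_state_two_eq`): the green `π/2` state is the red `-π/2` state times
  `√2 e^{iπ/4} · (1/√2)`;
* **LMCS Lemma 16** (`hBox_eq_euler_scalars`): the Euler decomposition of `H` with its exact
  scalar `(X^{(0,1)}(π) ⨾ Z^{(1,0)}(-π/4)) ⊗ (1/√2)`.

## References

* E. Jeandel, S. Perdrix, R. Vilmart, *Completeness of the ZX-calculus*, LMCS 16(2):11 (2020)
  (arXiv:1903.06035), App. A, Lemmas 14–16 and their proofs; conference version LICS 2018
  (arXiv:1705.11151v2) [JeandelPerdrixVilmart2018].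
-/

noncomputable section

namespace Literature.Computability.QuantumComplexity

open ZXDiagram ZXClass

namespace ZXClass

/-! ### Scalar toolkit: (K) on states, the unit scalars `√2 e^{iα}` -/

/-- Two scalars attached in front of a state on one wire regroup. [folklore] -/
theorem scalar_par_scalar_par_state (s t : ZXClass 0 0) (A : ZXClass 0 1) :
    s ⊠ (t ⊠ A) = (s ⊠ t) ⊠ A :=
  (par_assoc' _ _ _).trans (cast_id _ _ _)

/-- **(K) on a green state**: `√2 ⊗ (Z^{(0,1)}(α) ⨾ X^{(1,1)}(π)) = (X^{(0,1)}(π) ⨾ Z^{(1,0)}(α)) ⊗ Z^{(0,1)}(-α)`.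
[cite: JeandelPerdrixVilmart2018, Fig. 1 (K)] -/
theorem sqrt_two_par_Z_state_seq_X_pi (a : ZMod 8) :
    mk (dumbbell 0 0) ⊠ (mk (Z 0 1 a) ⨟ mk (X 1 1 4)) = mk (dumbbell 4 a) ⊠ mk (Z 0 1 (-a)) := by
  -- (K) in red/flipped form, fed with the green state `Z^{(0,1)}(0)`
  have h1 : mk (Z 0 1 0) ⨟ (mk (dumbbell 0 0) ⊠ (mk (X 1 1 4) ⨟ mk (Z 1 1 a))) =
      mk (Z 0 1 0) ⨟ (mk (dumbbell 4 a) ⊠ (mk (Z 1 1 (-a)) ⨟ mk (X 1 1 4))) := by rw [rule_K_red a]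
  rw [state_seq_scalar_par, state_seq_scalar_par] at h1
  simp only [← seq_assoc] at h1
  rw [Z_state_seq_X_phase_pi, Z_seq_Z 0 1 1 le_rfl, zero_add a, Z_seq_Z 0 1 1 le_rfl, zero_add (-a)] at h1
  -- h1 : √2 ⊠ Z01 a = db 4 a ⊠ (Z01(-a) ⨟ X11 4); append `X(π)` on both sides
  have h2 : (mk (dumbbell 0 0) ⊠ mk (Z 0 1 a)) ⨟ mk (X 1 1 4) =
      (mk (dumbbell 4 a) ⊠ (mk (Z 0 1 (-a)) ⨟ mk (X 1 1 4))) ⨟ mk (X 1 1 4) := by rw [h1]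
  rwa [scalar_par_state_seq, scalar_par_state_seq, seq_assoc, xphase_seq_xphase,
    show (4 : ZMod 8) + 4 = 0 from by decide, X_one_one, seq_id] at h2

/-- **Products of unit scalars** (JPV Lemma 6, colour-swapped):
`(X^{(0,1)}(π) ⨾ Z^{(1,0)}(α)) ⊗ (X^{(0,1)}(π) ⨾ Z^{(1,0)}(β)) = (X^{(0,1)}(π) ⨾ Z^{(1,0)}(α+β)) ⊗ √2`.
[cite: JeandelPerdrixVilmart2018, Appendix Lemma 6] -/
theorem dumbbell_four_mul (a b : ZMod 8) :
    mk (dumbbell 4 a) ⊠ mk (dumbbell 4 b) = mk (dumbbell 4 (a + b)) ⊠ mk (dumbbell 0 0) := by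
  have h := congrArg colorSwap (multiplying_global_phases a b)
  simpa [dumbbell] using h

/-- `X^{(0,1)}(π) ⨾ Z^{(1,0)}(α)` times `X^{(0,1)}(π) ⨾ Z^{(1,0)}(-α)` is `√2 ⊗ √2`. [cite: JeandelPerdrixVilmart2018, Appendix Lemmas 6, 7] -/
theorem dumbbell_four_par_dumbbell_four_neg (a : ZMod 8) :
    mk (dumbbell 4 a) ⊠ mk (dumbbell 4 (-a)) = mk (dumbbell 0 0) ⊠ mk (dumbbell 0 0) := by
  rw [dumbbell_four_mul, add_neg_cancel, dumbbell_four_zero]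

/-- **Cancellation of a unit scalar**: `X^{(0,1)}(π) ⨾ Z^{(1,0)}(α)` cancels on the left of scalars.
[cite: JeandelPerdrixVilmart2018, Appendix Lemmas 5, 6] -/
theorem cancel_dumbbell_four (a : ZMod 8) {s t : ZXClass 0 0}
    (h : mk (dumbbell 4 a) ⊠ s = mk (dumbbell 4 a) ⊠ t) : s = t := by
  have h' : mk (dumbbell 4 (-a)) ⊠ (mk (dumbbell 4 a) ⊠ s) = mk (dumbbell 4 (-a)) ⊠ (mk (dumbbell 4 a) ⊠ t) := by
    rw [h]
  rw [scalar_par_scalar_par (mk (dumbbell 4 (-a))) (mk (dumbbell 4 a)) s,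
    scalar_par_scalar_par (mk (dumbbell 4 (-a))) (mk (dumbbell 4 a)) t,
    show ∀ u : ZXClass 0 0, mk (dumbbell 4 a) ⊠ (mk (dumbbell 4 (-a)) ⊠ u) = (mk (dumbbell 4 a) ⊠ mk (dumbbell 4 (-a))) ⊠ u
      from fun u => (par_assoc' _ _ _).trans (cast_id _ _ _),
    show ∀ u : ZXClass 0 0, mk (dumbbell 4 a) ⊠ (mk (dumbbell 4 (-a)) ⊠ u) = (mk (dumbbell 4 a) ⊠ mk (dumbbell 4 (-a))) ⊠ u
      from fun u => (par_assoc' _ _ _).trans (cast_id _ _ _),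
    dumbbell_four_par_dumbbell_four_neg,
    show ∀ u : ZXClass 0 0, (mk (dumbbell 0 0) ⊠ mk (dumbbell 0 0)) ⊠ u = mk (dumbbell 0 0) ⊠ (mk (dumbbell 0 0) ⊠ u)
      from fun u => (par_assoc _ _ _).trans (cast_id _ _ _),
    show ∀ u : ZXClass 0 0, (mk (dumbbell 0 0) ⊠ mk (dumbbell 0 0)) ⊠ u = mk (dumbbell 0 0) ⊠ (mk (dumbbell 0 0) ⊠ u)
      from fun u => (par_assoc _ _ _).trans (cast_id _ _ _)] at h'
  exact cancel_sqrt_two_left_scalar (cancel_sqrt_two_left_scalar h')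

/-! ### LMCS Lemma 14: `1 + i = √2 e^{iπ/4}` -/

/-- Two green states may be exchanged by the crossing. [cite: JeandelPerdrixVilmart2018, §2.2] -/
theorem Z_states_seq_swap (a b : ZMod 8) :
    (mk (Z 0 1 a) ⊠ mk (Z 0 1 b)) ⨟ mk swap = mk (Z 0 1 b) ⊠ mk (Z 0 1 a) := by
  rw [← Z_state_seq_wires_par_state a b, seq_assoc, par_state_seq_swap,
    par_eq_seq_right (mk (Z 0 1 b)) (mk (Z 0 1 a)), empty_par_state]

/-- The closed diagram of LMCS Lemma 14's proof after (E), (H), (EU) is the empty diagram: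
`(Z^{(0,1)}(π/4) ⊗ Z^{(0,1)}(-π/2)) ⨾ X^{(2,1)} ⨾ Z^{(1,0)}(3π/4) = 1`. [cite: JeandelPerdrixVilmart2018, Appendix Lemma 14 (proof)] -/
theorem lemma14_core_eq_empty :
    (mk (Z 0 1 1) ⊠ mk (Z 0 1 (-2))) ⨟ mk (X 2 1 0) ⨟ mk (Z 1 0 3) = mk (wires 0) := by
  rw [← rule_E', X_state_eq, rule_EU]
  simp only [seq_assoc]
  rw [Z_seq_Z 1 1 0 le_rfl, ← seq_assoc (mk (Z 0 1 (-1))), Z_state_seq_phase_par,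
    show (-1 : ZMod 8) + 2 = 1 from by decide, show (2 : ZMod 8) + 1 = 3 from by decide]

/-- Step (K) + Lemma 6 of LMCS Lemma 14: with one `√2`, the core diagram acquires a red `π` and the
unit scalar `√2 e^{iπ/4}`. [cite: JeandelPerdrixVilmart2018, Appendix Lemma 14 (proof)] -/
theorem sqrt_two_par_lemma14_core :
    mk (dumbbell 0 0) ⊠ ((mk (Z 0 1 1) ⊠ mk (Z 0 1 (-2))) ⨟ mk (X 2 1 0) ⨟ mk (Z 1 0 3)) =
      mk (dumbbell 4 1) ⊠ ((mk (Z 0 1 (-1)) ⊠ mk (Z 0 1 (-2))) ⨟ mk (X 2 1 4) ⨟ mk (Z 1 0 3)) := by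
  have hS : ((mk (Z 0 1 1) ⨟ mk (X 1 1 4)) ⊠ mk (Z 0 1 (-2))) ⨟ (mk (X 1 1 4) ⊠ mk (wires 1)) =
      mk (Z 0 1 1) ⊠ mk (Z 0 1 (-2)) := by
    rw [interchange, seq_id, seq_assoc, xphase_seq_xphase, show (4 : ZMod 8) + 4 = 0 from by decide,
      X_one_one, seq_id]
  have hred : (mk (X 1 1 4) ⊠ mk (wires 1)) ⨟ mk (X 2 1 0) = mk (X 2 1 4) := by
    rw [X_par_seq_X 1 1 1 1 le_rfl, add_zero (4 : ZMod 8)]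
  have hK : mk (dumbbell 0 0) ⊠ ((mk (Z 0 1 1) ⨟ mk (X 1 1 4)) ⊠ mk (Z 0 1 (-2))) =
      mk (dumbbell 4 1) ⊠ (mk (Z 0 1 (-1)) ⊠ mk (Z 0 1 (-2))) := by
    rw [show ∀ (s : ZXClass 0 0) (A B : ZXClass 0 1), s ⊠ (A ⊠ B) = (s ⊠ A) ⊠ B
        from fun s A B => (par_assoc' _ _ _).trans (cast_id _ _ _),
      sqrt_two_par_Z_state_seq_X_pi,
      show ∀ (s : ZXClass 0 0) (A B : ZXClass 0 1), (s ⊠ A) ⊠ B = s ⊠ (A ⊠ B)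
        from fun s A B => (par_assoc _ _ _).trans (cast_id _ _ _)]
  rw [← hS]
  simp only [seq_assoc]
  rw [← seq_assoc (mk (X 1 1 4) ⊠ mk (wires 1)), hred, scalar_par_seq_left, hK, empty_par, cast_id,
    scalar_par_state_two_seq_zero]

/-- The crossing is absorbed by the red effect on three wires. [cite: JeandelPerdrixVilmart2018, §2.2] -/
theorem par_swap_seq_X_three_zero (a : ZMod 8) : (mk (wires 1) ⊠ mk swap) ⨟ mk (X 3 0 a) = mk (X 3 0 a) := by
  rw [show mk (X 3 0 a) = (mk (wires 1) ⊠ mk (X 2 1 0)) ⨟ mk (X 2 0 a) from by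
      rw [par_X_seq_X 1 2 1 0 le_rfl, add_zero],
    ← seq_assoc, ← wires_par_seq, swap_seq_X]

/-- Step (SUP) + Hopf of LMCS Lemma 14: with `√2 ⊗ √2`, the red `π` diagram is the scalar
`Z^{(0,0)}(π/2)` times the unit scalar `X^{(0,1)}(π) ⨾ Z^{(1,0)}(-π/2)`. [cite: JeandelPerdrixVilmart2018, Appendix Lemma 14 (proof)] -/
theorem sqrt_two_sq_par_lemma14_red :
    mk (dumbbell 0 0) ⊠ (mk (dumbbell 0 0) ⊠ ((mk (Z 0 1 (-1)) ⊠ mk (Z 0 1 (-2))) ⨟ mk (X 2 1 4) ⨟ mk (Z 1 0 3))) =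
      mk (Z 0 0 2) ⊠ mk (dumbbell 4 (-2)) := by
  -- 1. the green effect becomes a third state on a red `π` effect
  have h1 : mk (X 2 1 4) ⨟ mk (Z 1 0 3) = (mk (wires 2) ⊠ mk (Z 0 1 3)) ⨟ mk (X 3 0 4) := by
    rw [← par_state_seq_cap, ← X_two_zero, ← seq_assoc,
      show mk (X 2 1 4) ⨟ (mk (wires 1) ⊠ mk (Z 0 1 3)) = mk (X 2 1 4) ⊠ mk (Z 0 1 3) from by
        rw [par_eq_seq_left (mk (X 2 1 4)) (mk (Z 0 1 3)), par_empty],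
      par_eq_seq_right (mk (X 2 1 4)) (mk (Z 0 1 3)), seq_assoc, X_par_seq_X 2 1 1 0 le_rfl, add_zero (4 : ZMod 8)]
  have h1' : (mk (Z 0 1 (-1)) ⊠ mk (Z 0 1 (-2))) ⨟ mk (X 2 1 4) ⨟ mk (Z 1 0 3) =
      ((mk (Z 0 1 (-1)) ⊠ mk (Z 0 1 (-2))) ⊠ mk (Z 0 1 3)) ⨟ mk (X 3 0 4) := by
    rw [seq_assoc, h1, ← seq_assoc, par_eq_seq_left (mk (Z 0 1 (-1)) ⊠ mk (Z 0 1 (-2))) (mk (Z 0 1 3)), par_empty]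
  -- 2. exchange the last two states
  have h2 : ((mk (Z 0 1 (-1)) ⊠ mk (Z 0 1 3)) ⊠ mk (Z 0 1 (-2))) ⨟ (mk (wires 1) ⊠ mk swap) =
      (mk (Z 0 1 (-1)) ⊠ mk (Z 0 1 (-2))) ⊠ mk (Z 0 1 3) := by
    rw [par_assoc, cast_id, interchange, seq_id, Z_states_seq_swap, par_assoc', cast_id]
  have h2' : ((mk (Z 0 1 (-1)) ⊠ mk (Z 0 1 (-2))) ⊠ mk (Z 0 1 3)) ⨟ mk (X 3 0 4) =
      ((mk (Z 0 1 (-1)) ⊠ mk (Z 0 1 3)) ⊠ mk (Z 0 1 (-2))) ⨟ mk (X 3 0 4) := by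
    rw [← h2, seq_assoc, par_swap_seq_X_three_zero]
  -- 3. (SUP) on the states `-π/4`, `3π/4`
  have h3 : ((mk (Z 0 1 (-1)) ⊠ mk (Z 0 1 3)) ⊠ mk (Z 0 1 (-2))) ⨟ mk (X 3 0 4) =
      ((mk (Z 0 2 2) ⨟ mk (X 2 1 0)) ⊠ mk (Z 0 1 (-2))) ⨟ mk (X 2 0 4) := by
    rw [show mk (X 3 0 4) = (mk (X 2 1 0) ⊠ mk (wires 1)) ⨟ mk (X 2 0 4) from by
        rw [X_par_seq_X 2 1 1 0 le_rfl, zero_add], ← seq_assoc, interchange, seq_id,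
      show (3 : ZMod 8) = -1 + 4 from by decide, rule_SUP, show (2 : ZMod 8) * -1 + 4 = 2 from by decide]
  -- 4. Hopf
  have h4 : mk (dumbbell 0 0) ⊠ (mk (dumbbell 0 0) ⊠ (mk (Z 0 2 2) ⨟ mk (X 2 1 0))) = mk (Z 0 0 2) ⊠ mk (X 0 1 0) := by
    rw [show mk (Z 0 2 2) = mk (Z 0 1 2) ⨟ mk (Z 1 2 0) from by rw [Z_seq_Z 0 1 2 le_rfl, add_zero],
      seq_assoc, ← state_seq_scalar_par, ← state_seq_scalar_par, hopf_transpose,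
      ← seq_assoc, Z_seq_Z 0 1 0 le_rfl, add_zero (2 : ZMod 8), scalar_par_state, empty_par_state]
  -- 5. the red state fuses into the red effect
  have h5 : (mk (X 0 1 0) ⊠ mk (Z 0 1 (-2))) ⨟ mk (X 2 0 4) = mk (dumbbell 4 (-2)) := by
    rw [par_eq_seq_right (mk (X 0 1 0)) (mk (Z 0 1 (-2))), empty_par_state, seq_assoc,
      X_par_seq_X 0 1 1 0 le_rfl, zero_add (4 : ZMod 8), dumbbell_symm]
  have hin : ∀ (s : ZXClass 0 0) (A B : ZXClass 0 1) (Q : ZXClass 2 0), s ⊠ ((A ⊠ B) ⨟ Q) = ((s ⊠ A) ⊠ B) ⨟ Q :=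
    fun s A B Q => by
      rw [← scalar_par_state_two_seq_zero]; exact congrArg (· ⨟ Q) ((par_assoc' _ _ _).trans (cast_id _ _ _))
  rw [h1', h2', h3, hin, hin, h4, show (mk (Z 0 0 2) ⊠ mk (X 0 1 0)) ⊠ mk (Z 0 1 (-2)) = mk (Z 0 0 2) ⊠ (mk (X 0 1 0) ⊠ mk (Z 0 1 (-2)))
      from (par_assoc _ _ _).trans (cast_id _ _ _), scalar_par_state_two_seq_zero, h5]

/-- **LMCS Lemma 14**: `Z^{(0,0)}(π/2) = X^{(0,1)}(π) ⨾ Z^{(1,0)}(π/4)` (`1 + i = √2 e^{iπ/4}`).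
[cite: JeandelPerdrixVilmart2018, Appendix Lemma 14] -/
theorem Z_dot_two_eq : mk (Z 0 0 2) = mk (dumbbell 4 1) := by
  -- `√2 = db 4 1 ⊗ D` with `D` the red-`π` diagram, by the core lemma and (K)
  have hA : mk (dumbbell 0 0) = mk (dumbbell 4 1) ⊠ ((mk (Z 0 1 (-1)) ⊠ mk (Z 0 1 (-2))) ⨟ mk (X 2 1 4) ⨟ mk (Z 1 0 3)) := by
    rw [← sqrt_two_par_lemma14_core, lemma14_core_eq_empty, par_empty]
  -- `√2 ⊗ √2 ⊗ √2 = db 4 1 ⊗ Z00(π/2) ⊗ db 4 (-π/2) = Z00(π/2) ⊗ db 4 (-π/4) ⊗ √2`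
  have hB : mk (dumbbell 0 0) ⊠ (mk (dumbbell 0 0) ⊠ mk (dumbbell 0 0)) =
      (mk (Z 0 0 2) ⊠ mk (dumbbell 4 (-1))) ⊠ mk (dumbbell 0 0) := by
    have h0 : mk (dumbbell 0 0) ⊠ (mk (dumbbell 0 0) ⊠ mk (dumbbell 0 0)) = mk (dumbbell 0 0) ⊠ (mk (dumbbell 0 0) ⊠
        (mk (dumbbell 4 1) ⊠ ((mk (Z 0 1 (-1)) ⊠ mk (Z 0 1 (-2))) ⨟ mk (X 2 1 4) ⨟ mk (Z 1 0 3)))) := by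
      rw [← hA]
    rw [h0, scalar_par_scalar_par (mk (dumbbell 0 0)) (mk (dumbbell 4 1)),
      scalar_par_scalar_par (mk (dumbbell 0 0)) (mk (dumbbell 4 1)), sqrt_two_sq_par_lemma14_red,
      scalar_par_scalar_par (mk (dumbbell 4 1)) (mk (Z 0 0 2)), dumbbell_four_mul,
      show (1 : ZMod 8) + -2 = -1 from by decide]
    exact (par_assoc' _ _ _).trans (cast_id _ _ _)
  have hC : mk (dumbbell 0 0) ⊠ mk (dumbbell 0 0) = mk (Z 0 0 2) ⊠ mk (dumbbell 4 (-1)) :=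
    cancel_sqrt_two (((par_assoc _ _ _).trans (cast_id _ _ _)).trans hB)
  -- multiply by `db 4 1`: `db 4 (-1) ⊗ db 4 1 = √2 ⊗ √2`
  have hD : (mk (Z 0 0 2) ⊠ mk (dumbbell 4 (-1))) ⊠ mk (dumbbell 4 1) = mk (Z 0 0 2) ⊠ (mk (dumbbell 0 0) ⊠ mk (dumbbell 0 0)) := by
    rw [show (mk (Z 0 0 2) ⊠ mk (dumbbell 4 (-1))) ⊠ mk (dumbbell 4 1) = mk (Z 0 0 2) ⊠ (mk (dumbbell 4 (-1)) ⊠ mk (dumbbell 4 1))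
      from (par_assoc _ _ _).trans (cast_id _ _ _), dumbbell_four_mul, neg_add_cancel, dumbbell_four_zero]
  have hE : (mk (dumbbell 4 1) ⊠ mk (dumbbell 0 0)) ⊠ mk (dumbbell 0 0) = (mk (Z 0 0 2) ⊠ mk (dumbbell 0 0)) ⊠ mk (dumbbell 0 0) := by
    rw [show (mk (dumbbell 4 1) ⊠ mk (dumbbell 0 0)) ⊠ mk (dumbbell 0 0) = mk (dumbbell 4 1) ⊠ (mk (dumbbell 0 0) ⊠ mk (dumbbell 0 0))
        from (par_assoc _ _ _).trans (cast_id _ _ _),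
      show (mk (Z 0 0 2) ⊠ mk (dumbbell 0 0)) ⊠ mk (dumbbell 0 0) = mk (Z 0 0 2) ⊠ (mk (dumbbell 0 0) ⊠ mk (dumbbell 0 0))
        from (par_assoc _ _ _).trans (cast_id _ _ _),
      ← hD, ← hC, scalar_par_comm]
  exact (cancel_sqrt_two (cancel_sqrt_two hE)).symm

/-- LMCS Lemma 14, conjugated: `Z^{(0,0)}(-π/2) = X^{(0,1)}(π) ⨾ Z^{(1,0)}(-π/4)` (`1 - i = √2 e^{-iπ/4}`),
from Lemma 14 and `(1 - i)(1 + i) = 2 = √2 e^{-iπ/4} · √2 e^{iπ/4}`. [cite: JeandelPerdrixVilmart2018, Appendix Lemmas 13, 14] -/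
theorem Z_dot_neg_two_eq : mk (Z 0 0 (-2)) = mk (dumbbell 4 (-1)) := by
  apply cancel_dumbbell_four 1
  rw [scalar_par_comm, ← Z_dot_two_eq, Z_dot_neg_two_par_Z_dot_two, Z_dot_two_eq, dumbbell_four_mul,
    add_neg_cancel, dumbbell_four_zero]

/-- **LMCS Lemma 15**: the green `π/2` state is the red `-π/2` state up to the exact scalar
`√2 e^{iπ/4} · (1/√2)`: `Z^{(0,1)}(π/2) = (X^{(0,1)}(π) ⨾ Z^{(1,0)}(π/4)) ⊗ (1/√2) ⊗ X^{(0,1)}(-π/2)`.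
[cite: JeandelPerdrixVilmart2018, Appendix Lemma 15] -/
theorem Z_state_two_eq : mk (Z 0 1 2) = mk (dumbbell 4 1) ⊠ (mk invSqrtTwo ⊠ mk (X 0 1 (-2))) := by
  rw [Z_state_two, Z_dot_two_eq, scalar_par_scalar_par]

/-- **LMCS Lemma 16** (Euler decomposition with its scalar):
`H = (X^{(0,1)}(π) ⨾ Z^{(1,0)}(-π/4)) ⊗ (1/√2) ⊗ (Z(π/2) ⨾ X(π/2) ⨾ Z(π/2))`.
[cite: JeandelPerdrixVilmart2018, Appendix Lemma 16] -/
theorem hBox_eq_euler_scalars :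
    mk hBox = mk (dumbbell 4 (-1)) ⊠ (mk invSqrtTwo ⊠ (mk (Z 1 1 2) ⨟ mk (X 1 1 2) ⨟ mk (Z 1 1 2))) := by
  rw [hBox_eq_euler, Z_dot_neg_two_eq, scalar_par_scalar_par]

end ZXClass

end Literature.Computability.QuantumComplexity
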